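import Mathlib.RingTheory.Valuation.LocalSubring
import Mathlib.RingTheory.Henselian
import Mathlib.FieldTheory.IsAlgClosed.AlgebraicClosure
import Mathlib.RingTheory.Localization.Integral
import Mathlib.RingTheory.Polynomial.Content
import Mathlib.Algebra.CharP.Algebra
import Mathlib.Algebra.Algebra.ZMod
import Mathlib.Algebra.Algebra.Rat
import Mathlib.Algebra.Field.ZMod
import HarnessLib

/-!
# Valuation rings of an algebraically closed field: residue field, Hensel, places above `p`

Topic `RingTheory/Valuation`. Elementary facts about a valuation subring `A` of a field `K`
(Mathlib `ValuationSubring K`, a local ring with residue field `IsLocalRing.ResidueField A`),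
needed to reduce identities between points of elliptic curves over `ℚ̄` modulo a place above a
rational prime `p` (consumer: `Literature.NumberTheory.EllipticCurves`, reduction of isogenies
given by explicit formulae):

* `exists_valuationSubring_natCast_mem_maximalIdeal` — **places above `p` exist**: in a field of
  characteristic `0`, for every prime `p` there is a valuation subring whose maximal ideal
  contains `p` (Chevalley's extension theorem, Mathlib's
  `Ideal.image_subset_nonunits_valuationSubring`, applied to `pℤ ⊂ ℤ ⊆ K`).
* `exists_isRoot_sub_mem` — when `K` is **algebraically closed**, a monic polynomial over `A`
  splits over `K` with all its roots in `A` (`A` is integrally closed), so every root of its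
  reduction lifts to a root in `A`; hence `henselianRing_maximalIdeal` (`A` is henselian) and
  `isAlgClosed_residueField` (the residue field is algebraically closed).
* `charP_residueField` — if `p ∈ 𝔪_A` the residue field has characteristic `p`;
  `isAlgebraic_residueField` — if `K` is algebraic over `ℚ` the residue field is algebraic over
  `𝔽_p`, so that (`isAlgClosure_residueField`) it is an algebraic closure of `𝔽_p` and
  (`nonempty_residueField_ringEquiv`) is isomorphic to `AlgebraicClosure (ZMod p)`.

All of this is standard (e.g. Neukirch, *Algebraic Number Theory*, II §6; Zariski–Samuel II,
VI §4); Mathlib has the ingredients but not these packaged statements (`lean search` for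
`IsAlgClosed (IsLocalRing.ResidueField`, `HenselianRing` on `ValuationSubring` found nothing).

## Design

Theorems only (the `HenselianRing` and `IsAlgClosed` conclusions are stated as theorems, to be
introduced with `haveI` by consumers, not as global instances). `noncomputable section`; one
universe `u`.
-/

noncomputable section

open Polynomial IsLocalRing

universe u

namespace Literature.RingTheory.Valuation

variable {K : Type u} [Field K]

/-! ## Places above a rational prime -/

/-- **A place of a characteristic-zero field above a prime `p`**: there is a valuation subring
`A` of `K` with `p ∈ 𝔪_A` (Chevalley: the ideal `pℤ` of the subring `ℤ ⊆ K` is contained in the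
non-units of some valuation ring of `K` containing `ℤ`; Mathlib's
`Ideal.image_subset_nonunits_valuationSubring`). [folklore] -/
theorem exists_valuationSubring_natCast_mem_maximalIdeal [CharZero K] {p : ℕ} (hp : p.Prime) :
    ∃ A : ValuationSubring K, ((p : ℕ) : A) ∈ maximalIdeal A := by
  set S : Subring K := (Int.castRingHom K).range with hS
  have hpS : ((p : ℤ) : K) ∈ S := ⟨p, by simp⟩
  set I : Ideal S := Ideal.span {⟨((p : ℤ) : K), hpS⟩} with hI
  have hI : I ≠ ⊤ := by
    intro htop
    have h1 : (1 : S) ∈ I := htop ▸ Submodule.mem_top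
    rw [hI, Ideal.mem_span_singleton] at h1
    obtain ⟨⟨s, m, rfl⟩, hs⟩ := h1
    have h2 : ((p * m : ℤ) : K) = ((1 : ℤ) : K) := by
      have := congrArg Subtype.val hs
      simp only [Subring.coe_mul, eq_intCast, Int.cast_mul, Int.cast_natCast, OneMemClass.coe_one,
        Int.cast_one] at this ⊢
      exact this.symm
    have h3 : (p : ℤ) * m = 1 := Int.cast_injective h2
    have h4 : (p : ℤ) ∣ 1 := ⟨m, h3.symm⟩
    exact hp.one_lt.ne' (by exact_mod_cast Int.eq_one_of_dvd_one (by positivity) h4)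
  obtain ⟨A, -, hA⟩ := Ideal.image_subset_nonunits_valuationSubring I hI
  refine ⟨A, ?_⟩
  have hmem : ((p : ℤ) : K) ∈ A.nonunits :=
    hA ⟨⟨((p : ℤ) : K), hpS⟩, Ideal.subset_span rfl, rfl⟩
  obtain ⟨hpA, hmax⟩ := ValuationSubring.mem_nonunits_iff_exists_mem_maximalIdeal.mp hmem
  convert hmax using 1
  apply Subtype.ext
  simp

/-! ## Valuation rings of an algebraically closed field -/

section AlgClosed

variable (A : ValuationSubring K)

/-- An element of `K` integral over the valuation ring `A` lies in `A` (`A` is integrally closed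
in its fraction field `K`). [folklore] -/
theorem exists_algebraMap_eq_of_aeval_eq_zero {f : A[X]} (hf : f.Monic) {x : K}
    (hx : aeval x f = 0) : ∃ a : A, (a : K) = x :=
  IsIntegrallyClosed.isIntegral_iff.mp ⟨f, hf, hx⟩

variable [IsAlgClosed K]

/-- **A monic polynomial over `A` all of whose roots lie in `A` takes a value in `𝔪_A` at `a₀`
only if one of its roots is congruent to `a₀`**: `f = ∏ (X - rᵢ)` over the algebraically closed
`K` with `rᵢ ∈ A`, and `v(f(a₀)) = ∏ v(a₀ - rᵢ) < 1` forces `v(a₀ - rᵢ) < 1` for some `i`.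
[folklore] -/
theorem exists_isRoot_sub_mem {f : A[X]} (hf : f.Monic) {a₀ : A} (ha₀ : f.eval a₀ ∈ maximalIdeal A) :
    ∃ a : A, f.IsRoot a ∧ a - a₀ ∈ maximalIdeal A := by
  set ι := algebraMap A K with hι
  have hιinj : Function.Injective ι := IsFractionRing.injective A K
  set g := f.map ι with hg
  have hgm : g.Monic := hf.map ι
  have hsplit := IsAlgClosed.splits g
  -- evaluation upstairs
  have hkey : ∀ b : A, ι (f.eval b) = g.eval (ι b) := fun b ↦ by
    rw [hg, Polynomial.eval_map, Polynomial.eval₂_at_apply]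
  have haeval : ∀ x : K, aeval x f = g.eval x := fun x ↦ by
    rw [hg, Polynomial.eval_map, Polynomial.aeval_def]
  -- all roots of `g` lie in `A`
  have hrootsA : ∀ r ∈ g.roots, r ∈ A := fun r hr ↦ by
    have hroot : aeval r f = 0 := by
      rw [haeval]
      exact (Polynomial.mem_roots hgm.ne_zero).mp hr
    obtain ⟨b, hb⟩ := exists_algebraMap_eq_of_aeval_eq_zero A hf hroot
    exact hb ▸ b.2
  -- `v (f a₀) = ∏ v (a₀ - r) < 1`
  have hev : ι (f.eval a₀) = (g.roots.map fun r ↦ ι a₀ - r).prod := by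
    rw [hkey, hsplit.eval_eq_prod_roots_of_monic hgm]
  have hlt : A.valuation (ι (f.eval a₀)) < 1 := (A.valuation_lt_one_iff _).mp ha₀
  rw [hev, map_multiset_prod, Multiset.map_map] at hlt
  -- some factor has valuation `< 1`
  have hex : ∃ r ∈ g.roots, A.valuation (ι a₀ - r) < 1 := by
    by_contra hall
    push Not at hall
    have hge : ∀ r ∈ g.roots, A.valuation (ι a₀ - r) = 1 := fun r hr ↦ by
      refine le_antisymm ?_ (hall r hr)
      have : ι a₀ - r ∈ A := A.sub_mem a₀.2 (hrootsA r hr)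
      exact A.valuation_le_one ⟨_, this⟩
    have h1 : (Multiset.map ((fun x ↦ A.valuation x) ∘ fun r ↦ ι a₀ - r) g.roots).prod = 1 :=
      Multiset.prod_eq_one fun v hv ↦ by
        obtain ⟨r, hr, rfl⟩ := Multiset.mem_map.mp hv
        exact hge r hr
    rw [h1] at hlt
    exact lt_irrefl _ hlt
  obtain ⟨r, hr, hvr⟩ := hex
  obtain ⟨a, rfl⟩ : ∃ a : A, (a : K) = r := ⟨⟨r, hrootsA r hr⟩, rfl⟩
  refine ⟨a, ?_, ?_⟩
  · apply hιinj
    rw [map_zero, hkey]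
    exact (Polynomial.mem_roots hgm.ne_zero).mp hr
  · rw [A.valuation_lt_one_iff]
    have : A.valuation (((a - a₀ : A) : K)) = A.valuation (ι a₀ - a) := by
      rw [← Valuation.map_neg]
      congr 1
      simp [hι]
    rw [this]
    exact hvr

/-- **A valuation ring of an algebraically closed field is henselian** (indeed every root of the
reduction of a monic polynomial lifts, `exists_isRoot_sub_mem`; the simple-root hypothesis is not
needed). [folklore] -/
theorem henselianRing_maximalIdeal : HenselianRing A (maximalIdeal A) where
  jac := maximalIdeal_le_jacobson _
  is_henselian _ hf _ h₀ _ := exists_isRoot_sub_mem A hf h₀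

/-- **The residue field of a valuation ring of an algebraically closed field is algebraically
closed**: lift a monic polynomial over the residue field to a monic polynomial over `A`, take a
root in `K`; it lies in `A` and reduces to a root. [folklore] -/
theorem isAlgClosed_residueField : IsAlgClosed (ResidueField A) := by
  refine IsAlgClosed.of_exists_root _ fun q hq hirr ↦ ?_
  obtain ⟨f, hfq, hdeg, hf⟩ := Polynomial.lifts_and_natDegree_eq_and_monic
    ((Polynomial.mem_lifts _).mpr (Polynomial.map_surjective _ residue_surjective q)) hq
  have hdeg0 : (f.map (algebraMap A K)).degree ≠ 0 := by
    rw [Polynomial.degree_map_eq_of_injective (IsFractionRing.injective A K),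
      Polynomial.degree_eq_natDegree hf.ne_zero, hdeg]
    exact_mod_cast (hirr.natDegree_pos).ne'
  obtain ⟨x, hx⟩ := IsAlgClosed.exists_root _ hdeg0
  have hroot : aeval x f = 0 := by
    rw [Polynomial.aeval_def, ← Polynomial.eval_map]
    exact hx
  obtain ⟨a, rfl⟩ := exists_algebraMap_eq_of_aeval_eq_zero A hf hroot
  refine ⟨residue A a, ?_⟩
  have hfa : f.eval a = 0 := by
    apply IsFractionRing.injective A K
    rw [map_zero, ← Polynomial.eval₂_at_apply, ← Polynomial.aeval_def]
    exact hroot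
  rw [← hfq, Polynomial.eval_map, Polynomial.eval₂_at_apply, hfa, map_zero]

end AlgClosed

/-! ## The residue field at a place above `p` -/

section Residue

variable (A : ValuationSubring K) {p : ℕ} [Fact p.Prime]

/-- If `p ∈ 𝔪_A` the residue field of `A` has characteristic `p`. [folklore] -/
theorem charP_residueField (hpA : ((p : ℕ) : A) ∈ maximalIdeal A) : CharP (ResidueField A) p := by
  refine (CharP.charP_iff_prime_eq_zero Fact.out).mpr ?_
  rw [← map_natCast (residue A), residue_eq_zero_iff]
  exact hpA

/-- **The residue field at a place above `p` of a field algebraic over `ℚ` is algebraic over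
`𝔽_p`**: an element `a ∈ A` is a root of a primitive integer polynomial `G` (clear denominators in
its minimal polynomial over `ℚ`), whose reduction modulo `p` is a non-zero polynomial over `𝔽_p`
vanishing at `ā`. [folklore] -/
theorem isAlgebraic_residueField [CharZero K] [Algebra.IsAlgebraic ℚ K]
    (hpA : ((p : ℕ) : A) ∈ maximalIdeal A) :
    letI := charP_residueField A hpA
    letI := ZMod.algebra (ResidueField A) p
    Algebra.IsAlgebraic (ZMod p) (ResidueField A) := by
  letI := charP_residueField A hpA
  letI := ZMod.algebra (ResidueField A) p
  refine ⟨fun ξ ↦ ?_⟩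
  obtain ⟨a, rfl⟩ := residue_surjective ξ
  -- an integer polynomial vanishing at `a`
  have halg : IsAlgebraic ℚ (a : K) := Algebra.IsAlgebraic.isAlgebraic _
  obtain ⟨g, hg0, hga⟩ := halg
  set G : ℤ[X] := IsLocalization.integerNormalization (nonZeroDivisors ℤ) g with hG
  have hG0 : G ≠ 0 := mt IsFractionRing.integerNormalization_eq_zero_iff.mp hg0
  have hGa : aeval (a : K) G = 0 :=
    IsLocalization.integerNormalization_aeval_eq_zero (nonZeroDivisors ℤ) g hga
  -- its primitive part `P` still vanishes at `a`
  set P : ℤ[X] := G.primPart with hP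
  have hPprim : P.IsPrimitive := G.isPrimitive_primPart
  have hPa : aeval (a : K) P = 0 := by
    have h := G.eq_C_content_mul_primPart
    rw [h, map_mul, aeval_C, mul_eq_zero] at hGa
    rcases hGa with h1 | h1
    · exfalso
      rw [eq_intCast, Int.cast_eq_zero, Polynomial.content_eq_zero_iff] at h1
      exact hG0 h1
    · exact h1
  -- `P(a) = 0` in `A`, hence `P̄(ā) = 0` in the residue field
  have hPa' : aeval a P = 0 := by
    apply IsFractionRing.injective A K
    rw [map_zero, ← Polynomial.aeval_algebraMap_apply]
    exact hPa
  have hcomp : (algebraMap (ZMod p) (ResidueField A)).comp (Int.castRingHom (ZMod p)) =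
      (residue A).comp (algebraMap ℤ A) := RingHom.ext_int _ _
  have hred : aeval (residue A a) (P.map (Int.castRingHom (ZMod p))) = 0 := by
    rw [Polynomial.aeval_def, Polynomial.eval₂_map, hcomp, ← Polynomial.hom_eval₂,
      ← Polynomial.aeval_def, hPa', map_zero]
  -- and `P̄ ≠ 0` because `P` is primitive
  have hP0 : P.map (Int.castRingHom (ZMod p)) ≠ 0 := by
    intro h0
    have hdvd : (C (p : ℤ)) ∣ P := by
      rw [Polynomial.C_dvd_iff_dvd_coeff]
      intro n
      have := congrArg (fun q : (ZMod p)[X] ↦ q.coeff n) h0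
      simp only [Polynomial.coeff_map, eq_intCast, Polynomial.coeff_zero,
        ZMod.intCast_zmod_eq_zero_iff_dvd] at this
      exact this
    have hunit := hPprim (p : ℤ) hdvd
    rw [Int.isUnit_iff_natAbs_eq, Int.natAbs_natCast] at hunit
    exact (Fact.out : p.Prime).one_lt.ne' hunit
  exact ⟨P.map (Int.castRingHom (ZMod p)), hP0, hred⟩

/-- **The residue field at a place above `p` of the algebraic closure of a number field is an
algebraic closure of `𝔽_p`.** [folklore] -/
theorem isAlgClosure_residueField [CharZero K] [IsAlgClosed K] [Algebra.IsAlgebraic ℚ K]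
    (hpA : ((p : ℕ) : A) ∈ maximalIdeal A) :
    letI := charP_residueField A hpA
    letI := ZMod.algebra (ResidueField A) p
    IsAlgClosure (ZMod p) (ResidueField A) := by
  letI := charP_residueField A hpA
  letI := ZMod.algebra (ResidueField A) p
  exact ⟨isAlgClosed_residueField A, isAlgebraic_residueField A hpA⟩

/-- Consequently the residue field is (non-canonically) isomorphic to `AlgebraicClosure (ZMod p)`,
by a ring isomorphism compatible with the natural maps from `ZMod p`. [folklore] -/
theorem nonempty_residueField_ringEquiv [CharZero K] [IsAlgClosed K] [Algebra.IsAlgebraic ℚ K]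
    (hpA : ((p : ℕ) : A) ∈ maximalIdeal A) :
    letI := charP_residueField A hpA
    letI := ZMod.algebra (ResidueField A) p
    Nonempty (ResidueField A ≃ₐ[ZMod p] AlgebraicClosure (ZMod p)) := by
  letI := charP_residueField A hpA
  letI := ZMod.algebra (ResidueField A) p
  haveI := isAlgClosure_residueField A hpA
  exact ⟨IsAlgClosure.equiv (ZMod p) (ResidueField A) (AlgebraicClosure (ZMod p))⟩

end Residue

end Literature.RingTheory.Valuation
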